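import Summits.Ventures.Crystal3D.Theorems.StickyWulffConstantNoReconstructionGainExactPrep
import HarnessLib

/-!
# The LEVEL SANDWICH: exact zero gain bounds every packing's deficiency from below by its lattice bonds
# across any off-lattice-free level (line `replication-exactness`, toward the residual UNWRAP)

HONEST FRAMING. Part of the venture `Summits/Ventures/Crystal3D` (cell `crystal3d-full`), supports the
crux `NoReconstructionGain` (stmt-Ventures-19144, route `route-Ventures-StickyWulffConstant`), line
`replication-exactness` (lead wulff-p1 g17).  A NEW use of EXACT₀ that needs neither the core reduction
nor the compatible/wrapped split of the skeleton:

* `contactDeficiency_ge_latticeCross_of_exactZeroGain` — **LEVEL SANDWICH.**  Assume EXACT₀.  Let `X`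
  be ANY finite unit packing, `ν` a unit normal and `t` a level such that every OFF-LATTICE ball of `X`
  has `ν`-height at distance `≥ 1` from `t`.  Then
  `D(X) ≥ #{(x, y) ∈ X × X : x, y ∈ Λ₀, dist x y = 1, ⟪x,ν⟫ ≤ t < ⟪y,ν⟫}` —
  the deficiency of `X` is at least the number of its LATTICE bonds crossing the level.

Proof: `U = {⟪·,ν⟫ > t}` is a film on the half-crystal `H(ν,t)` (sites of `U` are sites; off-lattice
balls of `U` are `≥ 1` above the level), `L = {⟪·,ν⟫ ≤ t}` is a film on the reflected half-crystal
`H(−ν, −t')` for a `t' > t` below every site of `U`; EXACT₀ twice: `D(U) ≥ #{bonds L_site — U}`,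
`D(L) ≥ #{bonds U_site — L}`; and `D(X) = D(L) + D(U) − #{bonds L — U}` where no bond joins two
off-lattice balls across the level, so inclusion–exclusion leaves exactly the site–site bonds.

USE (recorded for the line; not yet formal): for `X ⊇ P_ρ(ν,R)` the lattice bonds of the SAMPLE crossing
an interior level number `2φ(ν)πρ² − O(ρ)` (mid-plane transversal count of `…LineCount`), so EXACT₀ gives
the crux's inequality for every packing admitting an off-lattice-free interior level — after deleting the
`≤ Cρ/12` off-lattice film balls near the best level (each costs `≤ 12`), for every packing whose film has
`≤ K·R·ρ` off-lattice balls in the wrapped band outside the disc; the residual UNWRAP thereby reduces to a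
CONFINEMENT statement for cores.

WHAT THIS IS NOT: the interior-level bond count and the confinement of cores are not proved here; rung
F-C1 not moved.
-/

noncomputable section

namespace Summit.Ventures.Crystal3D.Theorems

open Summit.Ventures.Crystal3D
open Literature.MathematicalPhysics.StatisticalMechanics (fccStacking isHaggSeq_const
  le_dist_of_mem_barlowStacking_ideal contactDeficiency orderedContacts)
open scoped InnerProductSpace
open Finset

open scoped Classical in
/-- **LEVEL SANDWICH.**  Under EXACT₀, the deficiency of any finite unit packing is at least the number
of its lattice bonds crossing any level `t` from which every off-lattice ball keeps height-distance `≥ 1`. -/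
theorem contactDeficiency_ge_latticeCross_of_exactZeroGain (hE : ExactZeroGain)
    {ν : EuclideanSpace ℝ (Fin 3)} (hν : ‖ν‖ = 1) (X : Finset (EuclideanSpace ℝ (Fin 3)))
    (hX : ∀ p ∈ X, ∀ q ∈ X, p ≠ q → 1 ≤ dist p q) (t : ℝ)
    (hoff : ∀ x ∈ X, x ∉ fccStacking 1 (Real.sqrt (2 / 3)) → 1 ≤ |⟪x, ν⟫_ℝ - t|) :
    ((((X ×ˢ X).filter fun pq : EuclideanSpace ℝ (Fin 3) × EuclideanSpace ℝ (Fin 3) =>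
        pq.1 ∈ fccStacking 1 (Real.sqrt (2 / 3)) ∧ pq.2 ∈ fccStacking 1 (Real.sqrt (2 / 3)) ∧
          dist pq.1 pq.2 = 1 ∧ ⟪pq.1, ν⟫_ℝ ≤ t ∧ t < ⟪pq.2, ν⟫_ℝ).card : ℕ) : ℝ) ≤
      contactDeficiency X := by
  classical
  set Λ := fccStacking 1 (Real.sqrt (2 / 3)) with hΛ
  set L := X.filter fun x => ⟪x, ν⟫_ℝ ≤ t with hL
  set U := X.filter fun x => ¬ ⟪x, ν⟫_ℝ ≤ t with hU
  have hLX : L ⊆ X := Finset.filter_subset _ _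
  have hUX : U ⊆ X := Finset.filter_subset _ _
  have hXL : X \ L = U := by rw [hL, hU, Finset.filter_not]
  have hmemL : ∀ x, x ∈ L ↔ x ∈ X ∧ ⟪x, ν⟫_ℝ ≤ t := fun x => by rw [hL, Finset.mem_filter]
  have hmemU : ∀ x, x ∈ U ↔ x ∈ X ∧ t < ⟪x, ν⟫_ℝ := fun x => by
    rw [hU, Finset.mem_filter, not_le]
  -- a level `t' > t` below every site of `U`
  obtain ⟨t', htt', hUt'⟩ : ∃ t' : ℝ, t < t' ∧ ∀ y ∈ U, y ∈ Λ → t' ≤ ⟪y, ν⟫_ℝ := by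
    by_cases hne : ((U.filter fun y => y ∈ Λ).image fun y => ⟪y, ν⟫_ℝ).Nonempty
    · refine ⟨((U.filter fun y => y ∈ Λ).image fun y => ⟪y, ν⟫_ℝ).min' hne, ?_, ?_⟩
      · obtain ⟨y, hy, hval⟩ := Finset.mem_image.1 (Finset.min'_mem _ hne)
        rw [← hval]
        exact ((hmemU y).1 (Finset.mem_filter.1 hy).1).2
      · intro y hy hyΛ
        exact Finset.min'_le _ _ (Finset.mem_image.2 ⟨y, Finset.mem_filter.2 ⟨hy, hyΛ⟩, rfl⟩)
    · refine ⟨t + 1, by linarith, fun y hy hyΛ => ?_⟩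
      exact absurd ⟨⟪y, ν⟫_ℝ, Finset.mem_image.2 ⟨y, Finset.mem_filter.2 ⟨hy, hyΛ⟩, rfl⟩⟩ hne
  -- height differences are at most distances
  have hhd : ∀ x y : EuclideanSpace ℝ (Fin 3), ⟪x, ν⟫_ℝ - ⟪y, ν⟫_ℝ ≤ dist x y := fun x y =>
    (le_abs_self _).trans (abs_inner_sub_le_dist hν x y)
  -- `U` is a film on `H(ν, t)`
  have hfilmU : IsFilmOn ν t U := by
    refine ⟨fun y hy y' hy' hne => hX y (hUX hy) y' (hUX hy') hne, ?_⟩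
    intro y hy z hz
    obtain ⟨hzΛ, hzt⟩ := hz
    have hyt := ((hmemU y).1 hy).2
    by_cases hyΛ : y ∈ Λ
    · have hne : y ≠ z := by rintro rfl; linarith
      exact le_dist_of_mem_barlowStacking_ideal isHaggSeq_const one_pos fcc_height_sq hyΛ hzΛ hne
    · have h1 := hoff y (hUX hy) hyΛ
      rw [abs_of_pos (by linarith)] at h1
      linarith [hhd y z]
  -- `L` is a film on `H(−ν, −t')`
  have hνn : ‖-ν‖ = 1 := by rw [norm_neg, hν]
  have hfilmL : IsFilmOn (-ν) (-t') L := by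
    refine ⟨fun x hx x' hx' hne => hX x (hLX hx) x' (hLX hx') hne, ?_⟩
    intro x hx z hz
    obtain ⟨hzΛ, hzt⟩ := hz
    rw [inner_neg_right, neg_le_neg_iff] at hzt
    have hxt := ((hmemL x).1 hx).2
    by_cases hxΛ : x ∈ Λ
    · have hne : x ≠ z := by rintro rfl; linarith
      exact le_dist_of_mem_barlowStacking_ideal isHaggSeq_const one_pos fcc_height_sq hxΛ hzΛ hne
    · have h1 := hoff x (hLX hx) hxΛ
      rw [abs_of_nonpos (by linarith)] at h1
      have := hhd z x
      rw [dist_comm] at this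
      linarith
  -- EXACT₀ twice
  have hEU := hE ν hν t U hfilmU
  have hEL := hE (-ν) hνn (-t') L hfilmL
  -- the cross bonds and their lattice parts
  set CB := (L ×ˢ U).filter fun pq => dist pq.1 pq.2 = 1 with hCB
  set Lon := L.filter fun x => x ∈ Λ with hLon
  set Uon := U.filter fun y => y ∈ Λ with hUon
  have hplugU : ((((Lon ×ˢ U).filter fun pq => dist pq.1 pq.2 = 1).card : ℕ) : ℝ) ≤
      plugCount ν t U := by
    rw [card_cross_eq_sum, plugCount]; push_cast
    refine Finset.sum_le_sum fun y hy => ?_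
    exact_mod_cast card_filter_le_plugSet_ncard ν t Lon y fun x hx _ =>
      ⟨(Finset.mem_filter.1 hx).2, ((hmemL x).1 (Finset.mem_filter.1 hx).1).2⟩
  have hplugL : ((((Uon ×ˢ L).filter fun pq => dist pq.1 pq.2 = 1).card : ℕ) : ℝ) ≤
      plugCount (-ν) (-t') L := by
    rw [card_cross_eq_sum, plugCount]; push_cast
    refine Finset.sum_le_sum fun x hx => ?_
    exact_mod_cast card_filter_le_plugSet_ncard (-ν) (-t') Uon x fun y hy _ =>
      ⟨(Finset.mem_filter.1 hy).2, by
        rw [inner_neg_right, neg_le_neg_iff]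
        exact hUt' y (Finset.mem_filter.1 hy).1 (Finset.mem_filter.1 hy).2⟩
  -- the two lattice parts of `CB`, by first / second coordinate
  have hA : ((Lon ×ˢ U).filter fun pq => dist pq.1 pq.2 = 1) = CB.filter fun pq => pq.1 ∈ Λ := by
    ext pq
    simp only [hCB, hLon, Finset.mem_filter, Finset.mem_product]
    tauto
  have hB : ((Uon ×ˢ L).filter fun pq => dist pq.1 pq.2 = 1).card = (CB.filter fun pq => pq.2 ∈ Λ).card := by
    refine Finset.card_nbij' Prod.swap Prod.swap ?_ ?_ (fun _ _ => rfl) (fun _ _ => rfl)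
    · intro pq hpq
      simp only [hCB, hUon, Finset.mem_coe, Finset.mem_filter, Finset.mem_product] at hpq ⊢
      refine ⟨⟨⟨hpq.1.2, hpq.1.1.1⟩, ?_⟩, hpq.1.1.2⟩
      rw [Prod.fst_swap, Prod.snd_swap, dist_comm]; exact hpq.2
    · intro pq hpq
      simp only [hCB, hUon, Finset.mem_coe, Finset.mem_filter, Finset.mem_product] at hpq ⊢
      refine ⟨⟨⟨hpq.1.1.2, hpq.2⟩, hpq.1.1.1⟩, ?_⟩
      rw [Prod.fst_swap, Prod.snd_swap, dist_comm]; exact hpq.1.2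
  -- no cross bond joins two off-lattice balls
  have hcover : CB.filter (fun pq => pq.1 ∈ Λ ∨ pq.2 ∈ Λ) = CB := by
    refine Finset.filter_true_of_mem fun pq hpq => ?_
    rw [hCB, Finset.mem_filter, Finset.mem_product] at hpq
    by_contra h
    push Not at h
    have h1 := hoff pq.1 (hLX hpq.1.1) h.1
    have h2 := hoff pq.2 (hUX hpq.1.2) h.2
    have hx := ((hmemL pq.1).1 hpq.1.1).2
    have hy := ((hmemU pq.2).1 hpq.1.2).2
    rw [abs_of_nonpos (by linarith)] at h1
    rw [abs_of_pos (by linarith)] at h2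
    have := hhd pq.2 pq.1
    rw [dist_comm, hpq.2] at this
    linarith
  -- inclusion–exclusion
  have hIE : (CB.filter fun pq => pq.1 ∈ Λ).card + (CB.filter fun pq => pq.2 ∈ Λ).card =
      CB.card + (CB.filter fun pq => pq.1 ∈ Λ ∧ pq.2 ∈ Λ).card := by
    have hu : (CB.filter fun pq => pq.1 ∈ Λ) ∪ (CB.filter fun pq => pq.2 ∈ Λ) = CB := by
      rw [← hcover]
      ext pq
      simp only [Finset.mem_union, Finset.mem_filter]
      tauto
    have hi : (CB.filter fun pq => pq.1 ∈ Λ) ∩ (CB.filter fun pq => pq.2 ∈ Λ) =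
        CB.filter fun pq => pq.1 ∈ Λ ∧ pq.2 ∈ Λ := by
      ext pq
      simp only [Finset.mem_inter, Finset.mem_filter]
      tauto
    have h := Finset.card_union_add_card_inter (CB.filter fun pq => pq.1 ∈ Λ)
      (CB.filter fun pq => pq.2 ∈ Λ)
    rw [hu, hi] at h
    omega
  -- the target set is the doubly-lattice part of `CB`
  have htarget : ((X ×ˢ X).filter fun pq : EuclideanSpace ℝ (Fin 3) × EuclideanSpace ℝ (Fin 3) =>
      pq.1 ∈ Λ ∧ pq.2 ∈ Λ ∧ dist pq.1 pq.2 = 1 ∧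
      ⟪pq.1, ν⟫_ℝ ≤ t ∧ t < ⟪pq.2, ν⟫_ℝ) = CB.filter fun pq => pq.1 ∈ Λ ∧ pq.2 ∈ Λ := by
    ext pq
    simp only [hCB, Finset.mem_filter, Finset.mem_product, hmemL, hmemU]
    tauto
  -- assemble
  have hsplit := contactDeficiency_sdiff_split (X := X) (P := L) hLX
  rw [hXL] at hsplit
  rw [htarget]
  have h1 : (((CB.filter fun pq => pq.1 ∈ Λ).card : ℕ) : ℝ) ≤ contactDeficiency U := by
    rw [← hA]; exact hplugU.trans hEU
  have h2 : (((CB.filter fun pq => pq.2 ∈ Λ).card : ℕ) : ℝ) ≤ contactDeficiency L := by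
    rw [← hB]; exact hplugL.trans hEL
  have h3 : (((CB.filter fun pq => pq.1 ∈ Λ).card : ℕ) : ℝ) + ((CB.filter fun pq => pq.2 ∈ Λ).card : ℕ)
      = (CB.card : ℝ) + ((CB.filter fun pq => pq.1 ∈ Λ ∧ pq.2 ∈ Λ).card : ℕ) := by
    exact_mod_cast hIE
  rw [hsplit]
  linarith

end Summit.Ventures.Crystal3D.Theorems

end
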